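import Summits.ResolutionOfSingularities.ResolutionOfSingularities.Theses.WildQuotients
import Literature.AlgebraicGeometry.Resolution.ResolutionOfComponents

/-!
# `WildQuotientResolution` — negative lemmas II: shape of a counterexample, load-bearing parts

Support (negative) lemmas for crux `stmt-ResolutionOfSingularities-15640`
(`Summit.ResolutionOfSingularities.ResolutionOfSingularities.Theses.WildQuotients.WildQuotientResolution`:
for every prime `p` and field `k` of characteristic `p`, every integral separated finite-type
`X₁ / k` receiving a finite surjective generically étale `q : X' → X₁` from a REGULAR integral `X'`,
invariant under an action `ρ : G →* Aut X'` of a finite group whose orbits are the fibres of `q`,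
has a resolution of singularities), filed by the standing disprover (cdisprove gen 1; work file
`Cruxes/WildQuotientResolution/Disproof.lean`). This file declares NO definition (variants of the
crux are written out inline) and NO declaration concludes a route decl positively.

* `not_resolutionOfSingularities_of_not_wildQuotientResolution` — the crux is a SPECIAL CASE of the
  summit (`X₁` is a reduced separated finite-type `k`-scheme): a disproof of the crux is a
  counterexample to resolution of singularities in characteristic `p`. None is known in any
  dimension; this is why every cheap attack fails.
* `not_wildQuotientResolution_iff` — the exact shape of a counterexample: a prime `p`, a field `k`,
  and a Galois-type quotient `X₁` of a regular `X'` (all eleven hypotheses) WITHOUT a weak resolution;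
  `exists_dim_gt_three_of_not_wildQuotientResolution` — modulo the named fact `CossartPiltant2019`
  such an `X₁` has dimension `≥ 4` (barrier `DimensionFourFrontier`), and
  `wq_hasResolution_of_dim_le_three` — the `dim X₁ ≤ 3` slice of the crux HOLDS modulo that fact.
* `not_wildQuotientResolution_of_not_cyclicWildQuotient`,
  `not_wildQuotientResolution_of_not_tameQuotientResolution` — the supports `CyclicWildQuotient`
  (`|G| = p`) and `TameQuotientResolution` (`p ∤ |G|`, `k` perfect) are literal specialisations, so
  a disproof of either disproves the crux.
* `wq_without_isRegular_iff_resolutionOfSingularities` — LOAD-BEARING: with `Scheme.IsRegular X'`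
  deleted the crux is EQUIVALENT to the summit (present an integral `X` as its own quotient by the
  trivial group, `q = 𝟙`, and descend reduced → integral by `hasResolution_of_forall_closeds`); so
  the dodge lives entirely in the regularity of the cover. (The sibling file
  `Theorems/SummitReduction/Negative/CounterexampleShape.lean` records the same for
  `Function.Surjective q.base`, via a closed point `Spec κ(x) → X`.)
* `wq_allNat_iff` — `p.Prime` is not load-bearing: over all naturals the statement is the crux plus
  one characteristic-`0` instance (no field has a composite characteristic).

## Sources
* V. Cossart, O. Piltant, J. Algebra 529 (2019), Thm. 1.1 (named fact `CossartPiltant2019`).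
* A. J. de Jong, Ann. Inst. Fourier 47 (1997), Cor. 5.15 (why quotients of regular schemes are the
  residue of the alteration programme).
* D. Bergh, D. Rydh, arXiv:1905.00872, Thm. 5 (tame case); F. Király, W. Lütkebohmert,
  arXiv:1001.1945, Thm. 2 (cyclic wild case, the route's terminal criterion).
-/

noncomputable section

-- single-problem summit: the doubled namespace component `ResolutionOfSingularities` is forced
set_option linter.dupNamespace false

open CategoryTheory AlgebraicGeometry TopologicalSpace Topology
open Literature.AlgebraicGeometry.Resolution

namespace Summit.ResolutionOfSingularities.ResolutionOfSingularities.Theorems.WildQuotientResolution.Negative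

open Summit.ResolutionOfSingularities.ResolutionOfSingularities.Theses.WildQuotients
  (WildQuotientResolution CyclicWildQuotient TameQuotientResolution)

/-! ## The crux is a special case of the summit -/

/-- **A disproof of the crux is a disproof of resolution of singularities in positive
characteristic**: `X₁` is integral (hence reduced), separated and of finite type over `k`, so
`ResolutionInChar p` resolves it directly, ignoring `X'`, `q`, `G`, `ρ`. [folklore] -/
theorem not_resolutionOfSingularities_of_not_wildQuotientResolution (h : ¬ WildQuotientResolution) :
    ¬ _root_.ResolutionOfSingularities := fun hR =>
  h fun p hp k _ _ _ X₁ f _ _ _ _ _ hs hl hq _ _ _ _ _ _ _ _ =>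
    (_root_.ResolutionOfSingularities_iff.mp hR) p hp k X₁ f hs hl hq inferInstance

/-- **The exact shape of a counterexample**: a prime `p`, a field `k` of characteristic `p` and a
Galois-type quotient `X₁` of a regular integral `X'` — all eleven hypotheses of the crux — such that
`X₁` has NO weak resolution (no proper birational `Y → X₁` with `Y` regular). [folklore] -/
theorem not_wildQuotientResolution_iff :
    ¬ WildQuotientResolution ↔ ∃ (p : ℕ), p.Prime ∧ ∃ (k : Type) (_ : Field k) (_ : CharP k p)
      (X' X₁ : Scheme.{0}) (f : X₁ ⟶ Spec (.of k)) (q : X' ⟶ X₁) (G : Type) (_ : Group G)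
      (_ : Finite G) (ρ : G →* Aut X'), IsSeparated f ∧ LocallyOfFiniteType f ∧ QuasiCompact f ∧
      IsIntegral X₁ ∧ IsIntegral X' ∧ Scheme.IsRegular X' ∧ IsFinite q ∧
      Function.Surjective q.base ∧ (∃ U : X₁.Opens, Dense (U : Set X₁) ∧ Etale (q ∣_ U)) ∧
      (∀ g : G, (ρ g).hom ≫ q = q) ∧ (∀ x y : X', q.base x = q.base y → ∃ g : G, (ρ g).hom.base x = y) ∧
      ¬ Scheme.HasResolution X₁ := by
  constructor
  · intro h
    by_contra hcon
    refine h fun p hp k _ _ X' X₁ f q G _ _ ρ hs hl hq hi1 hi' hreg hfin hsurj hU hinv horb => ?_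
    by_contra hX
    exact hcon ⟨p, hp, k, inferInstance, inferInstance, X', X₁, f, q, G, inferInstance, inferInstance,
      ρ, hs, hl, hq, hi1, hi', hreg, hfin, hsurj, hU, hinv, horb, hX⟩
  · rintro ⟨p, hp, k, _, _, X', X₁, f, q, G, _, _, ρ, hs, hl, hq, hi1, hi', hreg, hfin, hsurj, hU, hinv,
      horb, hX⟩ h
    exact hX (h p hp k X' X₁ f q G ρ hs hl hq hi1 hi' hreg hfin hsurj hU hinv horb)

/-- **The `dim ≤ 3` slice of the crux holds** modulo the named fact `CossartPiltant2019`
(Cossart–Piltant 2019, Thm. 1.1: every reduced separated finite-type scheme of dimension `≤ 3` over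
a field has a resolution) — the quotient structure is not even used. [cite: CossartPiltant2019, Thm. 1.1] -/
theorem wq_hasResolution_of_dim_le_three (hCP : CossartPiltant2019.{0}) {p : ℕ} {k : Type} [Field k]
    [CharP k p] (X₁ : Scheme.{0}) (f : X₁ ⟶ Spec (.of k)) [IsSeparated f] [LocallyOfFiniteType f]
    [QuasiCompact f] [IsIntegral X₁] (hdim : topologicalKrullDim X₁ ≤ 3) :
    Scheme.HasResolution X₁ :=
  hasResolution_of_dim_le_three hCP (p := p) k X₁ f hdim

/-- **Dimension `≥ 4`** (modulo `CossartPiltant2019`): the quotient `X₁` of a counterexample is not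
of dimension `≤ 3` — barrier `Literature.Barriers.ResolutionOfSingularities.DimensionFourFrontier`
applies to the crux verbatim. [cite: CossartPiltant2019, Thm. 1.1] -/
theorem exists_dim_gt_three_of_not_wildQuotientResolution (hCP : CossartPiltant2019.{0})
    (h : ¬ WildQuotientResolution) :
    ∃ (p : ℕ), p.Prime ∧ ∃ (k : Type) (_ : Field k) (_ : CharP k p)
      (X' X₁ : Scheme.{0}) (f : X₁ ⟶ Spec (.of k)) (q : X' ⟶ X₁) (G : Type) (_ : Group G)
      (_ : Finite G) (ρ : G →* Aut X'), IsSeparated f ∧ LocallyOfFiniteType f ∧ QuasiCompact f ∧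
      IsIntegral X₁ ∧ IsIntegral X' ∧ Scheme.IsRegular X' ∧ IsFinite q ∧
      Function.Surjective q.base ∧ (∃ U : X₁.Opens, Dense (U : Set X₁) ∧ Etale (q ∣_ U)) ∧
      (∀ g : G, (ρ g).hom ≫ q = q) ∧ (∀ x y : X', q.base x = q.base y → ∃ g : G, (ρ g).hom.base x = y) ∧
      ¬ topologicalKrullDim X₁ ≤ 3 ∧ ¬ Scheme.HasResolution X₁ := by
  obtain ⟨p, hp, k, _, _, X', X₁, f, q, G, _, _, ρ, hs, hl, hq, hi1, hi', hreg, hfin, hsurj, hU, hinv,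
    horb, hX⟩ := not_wildQuotientResolution_iff.mp h
  refine ⟨p, hp, k, inferInstance, inferInstance, X', X₁, f, q, G, inferInstance, inferInstance, ρ, hs,
    hl, hq, hi1, hi', hreg, hfin, hsurj, hU, hinv, horb, fun hdim => hX ?_, hX⟩
  haveI := hs; haveI := hl; haveI := hq
  exact wq_hasResolution_of_dim_le_three hCP (p := p) X₁ f hdim

/-! ## The supports are specialisations -/

/-- The support `CyclicWildQuotient` (the wild atom, `|G| = p`) is the crux with one more
hypothesis: **a disproof of the atom disproves the crux**. [folklore] -/
theorem not_wildQuotientResolution_of_not_cyclicWildQuotient (h : ¬ CyclicWildQuotient) :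
    ¬ WildQuotientResolution := fun hW =>
  h fun p hp k _ _ X' X₁ f q G _ _ ρ _ => hW p hp k X' X₁ f q G ρ

/-- The support `TameQuotientResolution` (`p ∤ |G|`, `k` perfect) is the crux with two more
hypotheses: **a disproof of the tame case disproves the crux**. [folklore] -/
theorem not_wildQuotientResolution_of_not_tameQuotientResolution (h : ¬ TameQuotientResolution) :
    ¬ WildQuotientResolution := fun hW =>
  h fun p hp k _ _ _ X' X₁ f q G _ _ ρ _ => hW p hp k X' X₁ f q G ρ

/-! ## Load-bearing hypotheses -/

/-- **`Scheme.IsRegular X'` carries the whole dodge**: the crux with the regularity of the cover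
DELETED is equivalent to the summit `ResolutionOfSingularities` itself. (`→`: present an integral
`X` as its own quotient by the trivial group — `X' = X₁ = X`, `q = 𝟙` is finite, surjective, étale
over `⊤`, invariant, with fibres = orbits — and descend reduced → integral through the integral
closed subschemes, `hasResolution_of_forall_closeds`; `←`: resolve `X₁` directly.) So any proof of
the crux must use the regularity of `X'`; without it the statement is the summit in costume.
[folklore] -/
theorem wq_without_isRegular_iff_resolutionOfSingularities :
    (∀ p : ℕ, p.Prime → ∀ (k : Type) [Field k] [CharP k p] (X' X₁ : Scheme.{0})
        (f : X₁ ⟶ Spec (.of k)) (q : X' ⟶ X₁) (G : Type) [Group G] [Finite G] (ρ : G →* Aut X'),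
        IsSeparated f → LocallyOfFiniteType f → QuasiCompact f → IsIntegral X₁ → IsIntegral X' →
        IsFinite q → Function.Surjective q.base →
        (∃ U : X₁.Opens, Dense (U : Set X₁) ∧ Etale (q ∣_ U)) → (∀ g : G, (ρ g).hom ≫ q = q) →
        (∀ x y : X', q.base x = q.base y → ∃ g : G, (ρ g).hom.base x = y) →
        Scheme.HasResolution X₁) ↔
      _root_.ResolutionOfSingularities := by
  constructor
  · intro h
    refine _root_.ResolutionOfSingularities_iff.mpr fun p hp k _ _ X f hs hl hq hr => ?_
    haveI := hl; haveI := hq; haveI := hr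
    refine hasResolution_of_forall_closeds X f fun Z hZ => ?_
    haveI := hZ
    haveI := hs
    set Y := (Scheme.IdealSheafData.vanishingIdeal Z).subscheme
    have h1 : ∀ g : PUnit.{1}, ((1 : PUnit.{1} →* Aut Y) g).hom = 𝟙 Y := fun _ => rfl
    refine h p hp k Y Y ((Scheme.IdealSheafData.vanishingIdeal Z).subschemeι ≫ f) (𝟙 Y) PUnit
      (1 : PUnit →* Aut Y) inferInstance inferInstance inferInstance hZ hZ inferInstance
      (fun y => ⟨y, rfl⟩) ⟨⊤, by simp, inferInstance⟩ (fun g => by rw [h1, Category.id_comp]) ?_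
    intro x y hxy
    exact ⟨1, by rw [h1]; exact hxy⟩
  · intro hR p hp k _ _ X' X₁ f q G _ _ ρ hs hl hq hi1 _ _ _ _ _ _
    exact (_root_.ResolutionOfSingularities_iff.mp hR) p hp k X₁ f hs hl hq inferInstance

/-- **`p.Prime` is not load-bearing**: over ALL naturals the statement is the crux together with
its characteristic-`0` instance (a composite `p ≠ 0` is the characteristic of no field, so those
instances are vacuous; `p = 0` is the char-`0` case, true by Hironaka + tame quotients but neither
needed nor refutable here). [folklore] -/
theorem wq_allNat_iff :
    (∀ (p : ℕ) (k : Type) [Field k] [CharP k p] (X' X₁ : Scheme.{0})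
        (f : X₁ ⟶ Spec (.of k)) (q : X' ⟶ X₁) (G : Type) [Group G] [Finite G] (ρ : G →* Aut X'),
        IsSeparated f → LocallyOfFiniteType f → QuasiCompact f → IsIntegral X₁ → IsIntegral X' →
        Scheme.IsRegular X' → IsFinite q → Function.Surjective q.base →
        (∃ U : X₁.Opens, Dense (U : Set X₁) ∧ Etale (q ∣_ U)) → (∀ g : G, (ρ g).hom ≫ q = q) →
        (∀ x y : X', q.base x = q.base y → ∃ g : G, (ρ g).hom.base x = y) →
        Scheme.HasResolution X₁) ↔
      WildQuotientResolution ∧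
      (∀ (k : Type) [Field k] [CharP k 0] (X' X₁ : Scheme.{0})
        (f : X₁ ⟶ Spec (.of k)) (q : X' ⟶ X₁) (G : Type) [Group G] [Finite G] (ρ : G →* Aut X'),
        IsSeparated f → LocallyOfFiniteType f → QuasiCompact f → IsIntegral X₁ → IsIntegral X' →
        Scheme.IsRegular X' → IsFinite q → Function.Surjective q.base →
        (∃ U : X₁.Opens, Dense (U : Set X₁) ∧ Etale (q ∣_ U)) → (∀ g : G, (ρ g).hom ≫ q = q) →
        (∀ x y : X', q.base x = q.base y → ∃ g : G, (ρ g).hom.base x = y) →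
        Scheme.HasResolution X₁) := by
  constructor
  · exact fun h => ⟨fun p _ => h p, h 0⟩
  · rintro ⟨h, h0⟩ p k _ _ X' X₁ f q G _ _ ρ hs hl hq hi1 hi' hreg hfin hsurj hU hinv horb
    by_cases hp : p.Prime
    · exact h p hp k X' X₁ f q G ρ hs hl hq hi1 hi' hreg hfin hsurj hU hinv horb
    · rcases CharP.char_is_prime_or_zero k p with hp' | rfl
      · exact absurd hp' hp
      · exact h0 k X' X₁ f q G ρ hs hl hq hi1 hi' hreg hfin hsurj hU hinv horb

end Summit.ResolutionOfSingularities.ResolutionOfSingularities.Theorems.WildQuotientResolution.Negative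

end
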